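import Literature.Topology.FourManifolds.RegularIntervalBoundary
import HarnessLib

/-!
# Two flow-outs of the boundary which agree away from it are conjugate

Topic `Literature/Topology/FourManifolds` (fact seat
`provefact-Literature.Topology.FourManifolds.IsHandlebody.exists_isBoundaryGluing_sphere`, step F2b of
the Lickorish–Wallace DAG; tool for the handle-extension step of the classification of
handlebodies `IsHandlebody.nonempty_diffeomorph`: it replaces the *uniqueness of collars* in the
normalisation of a diffeomorphism near a regular level).  Everything here is **proved**; no
named facts.

Let `M` be a compact manifold with boundary and `(f, ξ₁, δ)`, `(f, ξ₂, δ')` two flow-out inputs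
(`Literature.Topology.FourManifolds.FlowoutInput`, `BoundaryFlowout.lean`: `f ≥ 0` vanishes
exactly on `∂M`, `ξᵢ(f) = 1` near `∂M`) **with the same depth function `f`** and whose fields
**agree at depth `≥ η`**, with covers of height `≥ 4η`.  Writing `Flᵢ z s` for the flow-out of
the boundary point `z` to depth `s` and `retᵢ` for the retractions:

* `FlowoutInput.Cover.conj` — the map `μ x = Fl₂ (ret₂ (Fl₁ (ret₁ x) (f x + 2η))) (f x)` for
  `f x < 2η`, `μ x = x` otherwise: *go down along `ξ₁` by `2η` into the zone where the fields
  agree, come back up along `ξ₂` to the original depth*.  It preserves `f`, is the identity at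
  depth `≥ η`, and **conjugates the two flow-outs near the boundary**:
  `μ (Fl₁ z s) = Fl₂ (h z) s` for `s < 2η`, where `h z = ret₂ (Fl₁ z (2η))` is a bijection of
  `∂M` (`conjBd`, inverse `ret₁ (Fl₂ z (2η))`).
* `FlowoutInput.Cover.conjDiffeomorph` — `μ` is a diffeomorphism of `M` (its inverse is the same
  construction with the roles of `ξ₁`, `ξ₂` exchanged).

This is the time-`2η` "go down with one flow, up with the other" trick (the composite
`θ₂(2η) ∘ θ₁(-2η)` of flow maps), written with the one-sided flow-outs of a manifold with
boundary; cf. Milnor, *Lectures on the h-cobordism theorem* (1965), proof of Thm. 3.4 (the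
collar `V₀ × [0, 1] → W` given by the trajectories) and Hirsch, *Differential Topology* (1976),
Ch. 8, Thm. 1.8 (uniqueness of collars), of which it proves the special case of two flow
collars agreeing away from the boundary, without any isotopy-extension argument.

## References

* J. Milnor, *Lectures on the h-cobordism theorem*, Princeton (1965), proof of Thm. 3.4
  (PDF pp. 22–23). [MilnorHCobordism1965]
* M. W. Hirsch, *Differential Topology*, GTM 33 (1976), Ch. 4 §6 and Ch. 8, Thm. 1.8.
  [HirschDT1976]
-/

open scoped Manifold ContDiff Topology
open Set Function Filter

noncomputable section

namespace Literature.Topology.FourManifolds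

namespace FlowoutInput

universe u

variable {k : ℕ} {M : Type u} [TopologicalSpace M]
  [ChartedSpace (EuclideanHalfSpace (k + 1)) M] [IsManifold (𝓡∂ (k + 1)) ∞ M]

/-! ### Generic smoothness of maps built from the flow-out -/

namespace Cover

variable [T2Space M] {D : FlowoutInput k M} (Γ : D.Cover)

/-- `ret (Fl w t) = ret w`: points of one flow line have the same boundary point. [folklore] -/
theorem ret_Fl' {w : M} (hw : D.f w ≤ Γ.a) {t : ℝ} (ht : t ∈ Icc (-D.f w) (Γ.a - D.f w)) :
    Γ.ret (Γ.Fl w t) = Γ.ret w := by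
  rw [Γ.Fl_eq_Fl_ret hw ht]
  exact Γ.ret_Fl (Γ.f_ret hw) ⟨by linarith [ht.1], by linarith [ht.2]⟩

/-- The group law along a flow line from the boundary: `Fl (Fl z₀ s₁) s₂ = Fl z₀ (s₁ + s₂)`.
[folklore] -/
theorem Fl_Fl {z₀ : M} (hz₀ : D.f z₀ = 0) {s₁ s₂ : ℝ} (hs₁ : s₁ ∈ Icc 0 Γ.a)
    (hs₂ : s₂ ∈ Icc (-s₁) (Γ.a - s₁)) : Γ.Fl (Γ.Fl z₀ s₁) s₂ = Γ.Fl z₀ (s₁ + s₂) := by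
  have hz₀a : D.f z₀ ≤ Γ.a := by rw [hz₀]; exact Γ.a_pos.le
  have hf1 : D.f (Γ.Fl z₀ s₁) = s₁ := by
    rw [Γ.f_Fl hz₀a (by rw [hz₀, neg_zero]; exact hs₁), hz₀, zero_add]
  rw [Γ.Fl_eq_Fl_ret (by rw [hf1]; exact hs₁.2) (by rw [hf1]; exact hs₂), Γ.ret_Fl hz₀ hs₁, hf1]

/-- **Smoothness of `x ↦ Fl (g x) (τ x)`** for smooth `g` (with values of depth `< a`) and a
smooth nonnegative time `τ ≤ a` (locally it is the flow curve of a chart box). [folklore] -/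
theorem contMDiffOn_Fl_comp {E' H' : Type*} [NormedAddCommGroup E'] [NormedSpace ℝ E']
    [TopologicalSpace H'] {J : ModelWithCorners ℝ E' H'} {N : Type*} [TopologicalSpace N]
    [ChartedSpace H' N] {g : N → M} {τ : N → ℝ} {U : Set N}
    (hg : ContMDiffOn J (𝓡∂ (k + 1)) ∞ g U) (hτ : ContMDiffOn J 𝓘(ℝ, ℝ) ∞ τ U)
    (hga : ∀ x ∈ U, D.f (g x) < Γ.a) (hτ0 : ∀ x ∈ U, 0 ≤ τ x) (hτa : ∀ x ∈ U, τ x ≤ Γ.a) :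
    ContMDiffOn J (𝓡∂ (k + 1)) ∞ (fun x => Γ.Fl (g x) (τ x)) U := by
  intro x₀ hx₀
  obtain ⟨y, hy, hgd⟩ := Γ.cover (g x₀) (hga x₀ hx₀).le
  set O : Set N := U ∩ g ⁻¹' (Γ.bx y hy).dom with hO
  have hOU : O ∈ 𝓝[U] x₀ :=
    Filter.inter_mem self_mem_nhdsWithin ((hg.continuousOn x₀ hx₀).preimage_mem_nhdsWithin
      ((Γ.bx y hy).isOpen_dom.mem_nhds hgd))
  have h1 := Γ.contMDiffOn_curve y hy
  have h2 : ContMDiffOn J ((𝓡∂ (k + 1)).prod 𝓘(ℝ, ℝ)) ∞ (fun x => (g x, τ x)) O :=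
    (hg.mono inter_subset_left).prodMk (hτ.mono inter_subset_left)
  have h3 : ContMDiffOn J (𝓡∂ (k + 1)) ∞
      ((fun p : M × ℝ => (Γ.bx y hy).curve p.1 p.2) ∘ fun x => (g x, τ x)) O :=
    h1.comp h2 fun x hx => ⟨hx.2, hτ0 x hx.1, (hτa x hx.1).trans (Γ.a_le_ε y hy)⟩
  have h4 : ContMDiffOn J (𝓡∂ (k + 1)) ∞ (fun x => Γ.Fl (g x) (τ x)) O := by
    refine h3.congr fun x hx => ?_
    exact Γ.Fl_eq_of_mem_dom hy (hga x hx.1).le hx.2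
      ⟨by linarith [hτ0 x hx.1, D.f_nonneg (g x)], hτa x hx.1⟩
  exact (h4 x₀ ⟨hx₀, hgd⟩).mono_of_mem_nhdsWithin hOU

/-- **Smoothness of `x ↦ ret (g x)`** for smooth `g` with values of depth `< a`. [folklore] -/
theorem contMDiffOn_ret_comp {E' H' : Type*} [NormedAddCommGroup E'] [NormedSpace ℝ E']
    [TopologicalSpace H'] {J : ModelWithCorners ℝ E' H'} {N : Type*} [TopologicalSpace N]
    [ChartedSpace H' N] {g : N → M} {U : Set N}
    (hg : ContMDiffOn J (𝓡∂ (k + 1)) ∞ g U) (hga : ∀ x ∈ U, D.f (g x) < Γ.a) :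
    ContMDiffOn J (𝓡∂ (k + 1)) ∞ (fun x => Γ.ret (g x)) U := by
  intro x₀ hx₀
  obtain ⟨y, hy, hgd⟩ := Γ.cover (g x₀) (hga x₀ hx₀).le
  set O : Set N := U ∩ g ⁻¹' (Γ.bx y hy).dom with hO
  have hOU : O ∈ 𝓝[U] x₀ :=
    Filter.inter_mem self_mem_nhdsWithin ((hg.continuousOn x₀ hx₀).preimage_mem_nhdsWithin
      ((Γ.bx y hy).isOpen_dom.mem_nhds hgd))
  have h1 := Γ.contMDiffOn_ret y hy
  have h4 : ContMDiffOn J (𝓡∂ (k + 1)) ∞ (fun x => Γ.ret (g x)) O :=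
    h1.comp (hg.mono inter_subset_left) fun x hx => ⟨hx.2, hga x hx.1⟩
  exact (h4 x₀ ⟨hx₀, hgd⟩).mono_of_mem_nhdsWithin hOU

end Cover

/-! ### Two flow-outs with the same depth function -/

section TwoFields

variable [T2Space M] {D₁ D₂ : FlowoutInput k M} (hf : ∀ z, D₂.f z = D₁.f z)
  (Γ₁ : D₁.Cover) (Γ₂ : D₂.Cover) {η : ℝ}

namespace Cover

include hf in
/-- **A flow segment of `ξ₁` in the zone where `ξ₁ = ξ₂` is a flow segment of `ξ₂`** (forward
from a point of depth `≥ η`; uniqueness of integral curves). [folklore] -/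
theorem Fl_eq_Fl_of_agree (hagree : ∀ z, η ≤ D₁.f z → D₁.ξ z = D₂.ξ z) {w : M} (hwη : η ≤ D₁.f w)
    (hw₁ : D₁.f w ≤ Γ₁.a) (hw₂ : D₁.f w ≤ Γ₂.a) {T : ℝ} (hT₁ : T ≤ Γ₁.a)
    (hT₂ : T ≤ Γ₂.a) : ∀ t ∈ Icc 0 T, Γ₁.Fl w t = Γ₂.Fl w t := by
  have hw₂' : D₂.f w ≤ Γ₂.a := by rw [hf]; exact hw₂
  have h1 : IsMIntegralCurveOn (Γ₁.Fl w) D₁.ξ (Icc 0 T) :=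
    (Γ₁.isMIntegralCurveOn_Fl hw₁).mono (Icc_subset_Icc (by linarith [D₁.f_nonneg w]) hT₁)
  -- along the segment the depth is `≥ η`, so the fields agree
  have h1' : IsMIntegralCurveOn (Γ₁.Fl w) D₂.ξ (Icc 0 T) := by
    intro t ht
    have hdepth : η ≤ D₁.f (Γ₁.Fl w t) := by
      rw [Γ₁.f_Fl hw₁ ⟨by linarith [ht.1, D₁.f_nonneg w], ht.2.trans hT₁⟩]
      linarith [ht.1]
    rw [← hagree _ hdepth]
    exact h1 t ht
  have h2 : IsMIntegralCurveOn (Γ₂.Fl w) D₂.ξ (Icc 0 T) :=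
    (Γ₂.isMIntegralCurveOn_Fl hw₂').mono (Icc_subset_Icc (by linarith [D₂.f_nonneg w]) hT₂)
  have h0 : Γ₁.Fl w 0 = Γ₂.Fl w 0 := by rw [Γ₁.Fl_zero hw₁, Γ₂.Fl_zero hw₂']
  exact D₂.eqOn_of_eq_left h1' h2 h0

variable (η)

/-- **The boundary map** `h z = ret₂ (Fl₁ z (2η))` of the conjugation. [folklore] -/
def conjBd (z : M) : M := Γ₂.ret (Γ₁.Fl z (2 * η))

open scoped Classical in
/-- **The conjugating map** `μ`: below depth `2η`, go down along `ξ₁` by `2η` and come back up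
along `ξ₂` to the original depth; the identity elsewhere. [folklore] -/
def conj (x : M) : M :=
  if D₁.f x < 2 * η then Γ₂.Fl (Γ₂.ret (Γ₁.Fl (Γ₁.ret x) (D₁.f x + 2 * η))) (D₁.f x) else x

variable {η}

section Hyps

omit [T2Space M] in
include hf in
/-- The boundary map lands on the boundary: `f (h z) = 0` (for `f z = 0`). [folklore] -/
theorem f_conjBd (hη : 0 < η) (h4₁ : 4 * η ≤ Γ₁.a) (h4₂ : 4 * η ≤ Γ₂.a) {z : M}
    (hz : D₁.f z = 0) : D₁.f (conjBd Γ₁ Γ₂ η z) = 0 := by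
  have hza : D₁.f z ≤ Γ₁.a := by rw [hz]; exact Γ₁.a_pos.le
  have h2 : D₁.f (Γ₁.Fl z (2 * η)) = 2 * η := by
    rw [Γ₁.f_Fl hza (by rw [hz, neg_zero]; exact ⟨by linarith, by linarith⟩), hz, zero_add]
  rw [conjBd, ← hf, Γ₂.f_ret (by rw [hf, h2]; linarith)]

include hf in
/-- **The conjugation identity**: `μ (Fl₁ z s) = Fl₂ (h z) s` for a boundary point `z` and
`0 ≤ s < 2η`. [folklore] -/
theorem conj_Fl (hη : 0 < η) (h4₁ : 4 * η ≤ Γ₁.a) (h4₂ : 4 * η ≤ Γ₂.a)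
    (hagree : ∀ z, η ≤ D₁.f z → D₁.ξ z = D₂.ξ z) {z : M} (hz : D₁.f z = 0) {s : ℝ}
    (hs0 : 0 ≤ s) (hs : s < 2 * η) :
    conj Γ₁ Γ₂ η (Γ₁.Fl z s) = Γ₂.Fl (conjBd Γ₁ Γ₂ η z) s := by
  have hza : D₁.f z ≤ Γ₁.a := by rw [hz]; exact Γ₁.a_pos.le
  have hfs : D₁.f (Γ₁.Fl z s) = s := by
    rw [Γ₁.f_Fl hza (by rw [hz, neg_zero]; exact ⟨hs0, by linarith⟩), hz, zero_add]
  have hret : Γ₁.ret (Γ₁.Fl z s) = z := Γ₁.ret_Fl hz ⟨hs0, by linarith⟩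
  unfold conj
  rw [if_pos (by rw [hfs]; exact hs), hfs, hret]
  -- `Fl₁ z (s + 2η) = Fl₁ (Fl₁ z (2η)) s = Fl₂ (Fl₁ z (2η)) s`
  set w₀ := Γ₁.Fl z (2 * η) with hw₀
  have hfw₀ : D₁.f w₀ = 2 * η := by
    rw [hw₀, Γ₁.f_Fl hza (by rw [hz, neg_zero]; exact ⟨by linarith, by linarith⟩), hz, zero_add]
  have h1 : Γ₁.Fl z (s + 2 * η) = Γ₁.Fl w₀ s := by
    rw [hw₀, Γ₁.Fl_Fl hz ⟨by linarith, by linarith⟩ ⟨by linarith, by linarith⟩, add_comm]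
  have h2 : Γ₁.Fl w₀ s = Γ₂.Fl w₀ s :=
    Fl_eq_Fl_of_agree hf Γ₁ Γ₂ hagree (by rw [hfw₀]; linarith) (by rw [hfw₀]; linarith)
      (by rw [hfw₀]; linarith) (by linarith) (by linarith) s ⟨hs0, le_rfl⟩
  rw [h1, h2]
  -- `ret₂ (Fl₂ w₀ s) = ret₂ w₀ = h z`
  have hw₀₂ : D₂.f w₀ ≤ Γ₂.a := by rw [hf, hfw₀]; linarith
  rw [Γ₂.ret_Fl' hw₀₂ (by rw [hf, hfw₀]; exact ⟨by linarith, by linarith⟩)]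
  rfl

include hf in
/-- **The conjugating map is the identity at depth `≥ η`.** [folklore] -/
theorem conj_of_le (hη : 0 < η) (h4₁ : 4 * η ≤ Γ₁.a) (h4₂ : 4 * η ≤ Γ₂.a)
    (hagree : ∀ z, η ≤ D₁.f z → D₁.ξ z = D₂.ξ z) {x : M} (hx : η ≤ D₁.f x) :
    conj Γ₁ Γ₂ η x = x := by
  by_cases hx2 : D₁.f x < 2 * η
  · have hxa : D₁.f x ≤ Γ₁.a := by linarith
    -- `x = Fl₁ z s` with `z = ret₁ x`, `s = f x`
    have hz : D₁.f (Γ₁.ret x) = 0 := Γ₁.f_ret hxa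
    have hx' : x = Γ₁.Fl (Γ₁.ret x) (D₁.f x) := (Γ₁.Fl_ret hxa).symm
    conv_lhs => rw [hx']
    rw [conj_Fl hf Γ₁ Γ₂ hη h4₁ h4₂ hagree hz (D₁.f_nonneg x) hx2, conjBd]
    -- `Fl₁ z (2η) = Fl₁ x (2η - f x) = Fl₂ x (2η - f x)`
    have h1 : Γ₁.Fl (Γ₁.ret x) (2 * η) = Γ₁.Fl x (2 * η - D₁.f x) := by
      rw [Γ₁.Fl_eq_Fl_ret hxa ⟨by linarith, by linarith⟩]
      congr 1; ring
    have h2 : Γ₁.Fl x (2 * η - D₁.f x) = Γ₂.Fl x (2 * η - D₁.f x) :=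
      Fl_eq_Fl_of_agree hf Γ₁ Γ₂ hagree hx hxa (by linarith) (by linarith) (by linarith)
        _ ⟨by linarith, le_rfl⟩
    have hxa₂ : D₂.f x ≤ Γ₂.a := by rw [hf]; linarith
    rw [h1, h2, Γ₂.ret_Fl' hxa₂ (by rw [hf]; exact ⟨by linarith, by linarith⟩)]
    have h3 := Γ₂.Fl_ret hxa₂
    rw [hf] at h3
    exact h3
  · unfold conj; rw [if_neg hx2]

include hf in
/-- The conjugating map preserves the depth. [folklore] -/
theorem f_conj (hη : 0 < η) (h4₁ : 4 * η ≤ Γ₁.a) (h4₂ : 4 * η ≤ Γ₂.a)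
    (hagree : ∀ z, η ≤ D₁.f z → D₁.ξ z = D₂.ξ z) (x : M) :
    D₁.f (conj Γ₁ Γ₂ η x) = D₁.f x := by
  by_cases hx2 : D₁.f x < 2 * η
  · have hxa : D₁.f x ≤ Γ₁.a := by linarith
    have hz : D₁.f (Γ₁.ret x) = 0 := Γ₁.f_ret hxa
    have hx' : x = Γ₁.Fl (Γ₁.ret x) (D₁.f x) := (Γ₁.Fl_ret hxa).symm
    conv_lhs => rw [hx']
    rw [conj_Fl hf Γ₁ Γ₂ hη h4₁ h4₂ hagree hz (D₁.f_nonneg x) hx2]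
    have hb : D₁.f (conjBd Γ₁ Γ₂ η (Γ₁.ret x)) = 0 := f_conjBd hf Γ₁ Γ₂ hη h4₁ h4₂ hz
    have hba : D₂.f (conjBd Γ₁ Γ₂ η (Γ₁.ret x)) ≤ Γ₂.a := by rw [hf, hb]; exact Γ₂.a_pos.le
    rw [← hf, Γ₂.f_Fl hba (by rw [hf, hb, neg_zero]; exact ⟨D₁.f_nonneg x, by linarith⟩), hf,
      hb, zero_add]
  · unfold conj; rw [if_neg hx2]

include hf in
/-- **The conjugating map is smooth.** [folklore] -/
theorem contMDiff_conj (hη : 0 < η) (h4₁ : 4 * η ≤ Γ₁.a) (h4₂ : 4 * η ≤ Γ₂.a)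
    (hagree : ∀ z, η ≤ D₁.f z → D₁.ξ z = D₂.ξ z) :
    ContMDiff (𝓡∂ (k + 1)) (𝓡∂ (k + 1)) ∞ (conj Γ₁ Γ₂ η) := by
  intro x₀
  by_cases hx₀ : D₁.f x₀ < 2 * η
  · -- the formula, on the open set `{f < 2η}`
    set U : Set M := {x | D₁.f x < 2 * η} with hU
    have hUo : IsOpen U := isOpen_lt D₁.f_smooth.continuous continuous_const
    have hfs : ContMDiffOn (𝓡∂ (k + 1)) 𝓘(ℝ, ℝ) ∞ D₁.f U := D₁.f_smooth.contMDiffOn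
    -- `x ↦ ret₁ x`
    have h1 : ContMDiffOn (𝓡∂ (k + 1)) (𝓡∂ (k + 1)) ∞ (fun x => Γ₁.ret x) U :=
      Γ₁.contMDiffOn_ret_comp contMDiffOn_id fun x hx => by
        show D₁.f x < Γ₁.a; exact lt_of_lt_of_le hx (by linarith)
    -- `x ↦ Fl₁ (ret₁ x) (f x + 2η)`
    have h2 : ContMDiffOn (𝓡∂ (k + 1)) (𝓡∂ (k + 1)) ∞
        (fun x => Γ₁.Fl (Γ₁.ret x) (D₁.f x + 2 * η)) U := by
      refine Γ₁.contMDiffOn_Fl_comp h1 (hfs.add contMDiffOn_const) (fun x hx => ?_)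
        (fun x hx => by linarith [D₁.f_nonneg x]) (fun x hx => ?_)
      · rw [Γ₁.f_ret (by show D₁.f x ≤ Γ₁.a; exact le_of_lt (lt_of_lt_of_le hx (by linarith)))]
        exact Γ₁.a_pos
      · show D₁.f x + 2 * η ≤ Γ₁.a
        have : D₁.f x < 2 * η := hx
        linarith
    have hdepth : ∀ x ∈ U, D₁.f (Γ₁.Fl (Γ₁.ret x) (D₁.f x + 2 * η)) = D₁.f x + 2 * η := by
      intro x hx
      have hx' : D₁.f x < 2 * η := hx
      have hxa : D₁.f x ≤ Γ₁.a := by linarith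
      have hz : D₁.f (Γ₁.ret x) = 0 := Γ₁.f_ret hxa
      rw [Γ₁.f_Fl (by rw [hz]; exact Γ₁.a_pos.le)
        (by rw [hz, neg_zero]; exact ⟨by linarith [D₁.f_nonneg x], by linarith⟩), hz, zero_add]
    -- `x ↦ ret₂ (…)`
    have h3 : ContMDiffOn (𝓡∂ (k + 1)) (𝓡∂ (k + 1)) ∞
        (fun x => Γ₂.ret (Γ₁.Fl (Γ₁.ret x) (D₁.f x + 2 * η))) U :=
      Γ₂.contMDiffOn_ret_comp h2 fun x hx => by
        rw [hf, hdepth x hx]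
        have : D₁.f x < 2 * η := hx
        linarith
    -- `x ↦ Fl₂ (ret₂ …) (f x)`
    have h4 : ContMDiffOn (𝓡∂ (k + 1)) (𝓡∂ (k + 1)) ∞
        (fun x => Γ₂.Fl (Γ₂.ret (Γ₁.Fl (Γ₁.ret x) (D₁.f x + 2 * η))) (D₁.f x)) U := by
      refine Γ₂.contMDiffOn_Fl_comp h3 hfs (fun x hx => ?_) (fun x _ => D₁.f_nonneg x)
        (fun x hx => ?_)
      · rw [Γ₂.f_ret]
        · exact Γ₂.a_pos
        · rw [hf, hdepth x hx]
          have : D₁.f x < 2 * η := hx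
          linarith
      · have : D₁.f x < 2 * η := hx
        linarith
    have h5 : ContMDiffOn (𝓡∂ (k + 1)) (𝓡∂ (k + 1)) ∞ (conj Γ₁ Γ₂ η) U := by
      refine h4.congr fun x hx => ?_
      unfold conj
      rw [if_pos (show D₁.f x < 2 * η from hx)]
    exact (h5 x₀ hx₀).contMDiffAt (hUo.mem_nhds hx₀)
  · -- the identity, on the open set `{η < f}`
    have hO : IsOpen {x : M | η < D₁.f x} := isOpen_lt continuous_const D₁.f_smooth.continuous
    have hx₀' : η < D₁.f x₀ := by linarith [not_lt.1 hx₀]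
    refine (contMDiff_id.contMDiffOn.congr fun x hx => ?_).contMDiffAt (hO.mem_nhds hx₀')
    exact conj_of_le hf Γ₁ Γ₂ hη h4₁ h4₂ hagree (le_of_lt hx)

end Hyps

end Cover

end TwoFields

/-! ### The conjugating diffeomorphism -/

section Diffeo

variable [T2Space M] {D₁ D₂ : FlowoutInput k M} (hf : ∀ z, D₂.f z = D₁.f z)
  (Γ₁ : D₁.Cover) (Γ₂ : D₂.Cover) {η : ℝ}

namespace Cover

omit [T2Space M] in
include hf in
/-- The symmetric hypotheses. [folklore] -/
theorem agree_symm (hagree : ∀ z, η ≤ D₁.f z → D₁.ξ z = D₂.ξ z) :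
    ∀ z, η ≤ D₂.f z → D₂.ξ z = D₁.ξ z := fun z hz =>
  (hagree z (by rw [← hf]; exact hz)).symm

include hf in
/-- `h' (h z) = z` on the boundary, `h'` the boundary map of the exchanged pair. [folklore] -/
theorem conjBd_conjBd (hη : 0 < η) (h4₁ : 4 * η ≤ Γ₁.a) (h4₂ : 4 * η ≤ Γ₂.a) {z : M}
    (hz : D₁.f z = 0) : conjBd Γ₂ Γ₁ η (conjBd Γ₁ Γ₂ η z) = z := by
  have hza : D₁.f z ≤ Γ₁.a := by rw [hz]; exact Γ₁.a_pos.le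
  set w₀ := Γ₁.Fl z (2 * η) with hw₀
  have hfw₀ : D₁.f w₀ = 2 * η := by
    rw [hw₀, Γ₁.f_Fl hza (by rw [hz, neg_zero]; exact ⟨by linarith, by linarith⟩), hz, zero_add]
  have hw₀₂ : D₂.f w₀ ≤ Γ₂.a := by rw [hf, hfw₀]; linarith
  unfold conjBd
  -- `Fl₂ (ret₂ w₀) (2η) = Fl₂ (ret₂ w₀) (f w₀) = w₀`
  have h1 : Γ₂.Fl (Γ₂.ret w₀) (2 * η) = w₀ := by
    have h := Γ₂.Fl_ret hw₀₂
    rwa [hf, hfw₀] at h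
  rw [h1, hw₀]
  exact Γ₁.ret_Fl hz ⟨by linarith, by linarith⟩

include hf in
/-- `μ' (μ x) = x`, `μ'` the conjugating map of the exchanged pair. [folklore] -/
theorem conj_conj (hη : 0 < η) (h4₁ : 4 * η ≤ Γ₁.a) (h4₂ : 4 * η ≤ Γ₂.a)
    (hagree : ∀ z, η ≤ D₁.f z → D₁.ξ z = D₂.ξ z) (x : M) :
    conj Γ₂ Γ₁ η (conj Γ₁ Γ₂ η x) = x := by
  have hf' : ∀ z, D₁.f z = D₂.f z := fun z => (hf z).symm
  have hagree' := agree_symm hf hagree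
  by_cases hx2 : D₁.f x < 2 * η
  · have hxa : D₁.f x ≤ Γ₁.a := by linarith
    have hz : D₁.f (Γ₁.ret x) = 0 := Γ₁.f_ret hxa
    have hx' : x = Γ₁.Fl (Γ₁.ret x) (D₁.f x) := (Γ₁.Fl_ret hxa).symm
    conv_lhs => rw [hx']
    rw [conj_Fl hf Γ₁ Γ₂ hη h4₁ h4₂ hagree hz (D₁.f_nonneg x) hx2]
    have hb : D₂.f (conjBd Γ₁ Γ₂ η (Γ₁.ret x)) = 0 := by
      rw [hf]; exact f_conjBd hf Γ₁ Γ₂ hη h4₁ h4₂ hz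
    rw [conj_Fl hf' Γ₂ Γ₁ hη h4₂ h4₁ hagree' hb (D₁.f_nonneg x) hx2,
      conjBd_conjBd hf Γ₁ Γ₂ hη h4₁ h4₂ hz]
    exact Γ₁.Fl_ret hxa
  · have h1 : conj Γ₁ Γ₂ η x = x := by unfold conj; rw [if_neg hx2]
    rw [h1]
    unfold conj
    rw [if_neg (by rw [hf]; exact hx2)]

/-- **The conjugating diffeomorphism** of two flow-outs with the same depth function whose
fields agree at depth `≥ η` (covers of height `≥ 4η`). [cite: HirschDT1976, Ch. 8, Thm. 1.8 (uniqueness of collars; the case of flow collars agreeing away from the boundary)] -/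
def conjDiffeomorph (hη : 0 < η) (h4₁ : 4 * η ≤ Γ₁.a) (h4₂ : 4 * η ≤ Γ₂.a)
    (hagree : ∀ z, η ≤ D₁.f z → D₁.ξ z = D₂.ξ z) : M ≃ₘ⟮𝓡∂ (k + 1), 𝓡∂ (k + 1)⟯ M where
  toFun := conj Γ₁ Γ₂ η
  invFun := conj Γ₂ Γ₁ η
  left_inv := conj_conj hf Γ₁ Γ₂ hη h4₁ h4₂ hagree
  right_inv := conj_conj (fun z => (hf z).symm) Γ₂ Γ₁ hη h4₂ h4₁ (agree_symm hf hagree)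
  contMDiff_toFun := contMDiff_conj hf Γ₁ Γ₂ hη h4₁ h4₂ hagree
  contMDiff_invFun := contMDiff_conj (fun z => (hf z).symm) Γ₂ Γ₁ hη h4₂ h4₁ (agree_symm hf hagree)

/-- The conjugating diffeomorphism is the map `conj`. [folklore] -/
@[simp]
theorem coe_conjDiffeomorph (hη : 0 < η) (h4₁ : 4 * η ≤ Γ₁.a) (h4₂ : 4 * η ≤ Γ₂.a)
    (hagree : ∀ z, η ≤ D₁.f z → D₁.ξ z = D₂.ξ z) :
    ⇑(conjDiffeomorph hf Γ₁ Γ₂ hη h4₁ h4₂ hagree) = conj Γ₁ Γ₂ η := rfl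

include hf in
/-- **Summary**: the conjugating diffeomorphism `μ` preserves the depth, is the identity at
depth `≥ η`, and conjugates the flow-out of `ξ₁` to the flow-out of `ξ₂` near the boundary,
`μ (Fl₁ z s) = Fl₂ (h z) s` (`0 ≤ s < 2η`), through the bijection `h = conjBd` of the boundary
(inverse `conjBd` of the exchanged pair). [cite: MilnorHCobordism1965, proof of Thm. 3.4 (PDF pp. 22–23)] -/
theorem conjDiffeomorph_spec (hη : 0 < η) (h4₁ : 4 * η ≤ Γ₁.a) (h4₂ : 4 * η ≤ Γ₂.a)
    (hagree : ∀ z, η ≤ D₁.f z → D₁.ξ z = D₂.ξ z) :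
    (∀ x, D₁.f (conjDiffeomorph hf Γ₁ Γ₂ hη h4₁ h4₂ hagree x) = D₁.f x) ∧
    (∀ x, η ≤ D₁.f x → conjDiffeomorph hf Γ₁ Γ₂ hη h4₁ h4₂ hagree x = x) ∧
    (∀ z, D₁.f z = 0 → D₁.f (conjBd Γ₁ Γ₂ η z) = 0) ∧
    (∀ z, D₁.f z = 0 → conjBd Γ₂ Γ₁ η (conjBd Γ₁ Γ₂ η z) = z) ∧
    (∀ z, D₁.f z = 0 → conjBd Γ₁ Γ₂ η (conjBd Γ₂ Γ₁ η z) = z) ∧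
    ∀ z s, D₁.f z = 0 → 0 ≤ s → s < 2 * η →
      conjDiffeomorph hf Γ₁ Γ₂ hη h4₁ h4₂ hagree (Γ₁.Fl z s) = Γ₂.Fl (conjBd Γ₁ Γ₂ η z) s := by
  refine ⟨f_conj hf Γ₁ Γ₂ hη h4₁ h4₂ hagree, fun x hx => conj_of_le hf Γ₁ Γ₂ hη h4₁ h4₂ hagree hx,
    fun z hz => f_conjBd hf Γ₁ Γ₂ hη h4₁ h4₂ hz,
    fun z hz => conjBd_conjBd hf Γ₁ Γ₂ hη h4₁ h4₂ hz, fun z hz => ?_,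
    fun z s hz hs0 hs => conj_Fl hf Γ₁ Γ₂ hη h4₁ h4₂ hagree hz hs0 hs⟩
  exact conjBd_conjBd (fun z => (hf z).symm) Γ₂ Γ₁ hη h4₂ h4₁ (by rw [hf]; exact hz)

include hf in
/-- The boundary map `conjBd` is smooth near the boundary (on `{f < 2η}`). [folklore] -/
theorem contMDiffOn_conjBd (hη : 0 < η) (h4₁ : 4 * η ≤ Γ₁.a) (h4₂ : 4 * η ≤ Γ₂.a) :
    ContMDiffOn (𝓡∂ (k + 1)) (𝓡∂ (k + 1)) ∞ (conjBd Γ₁ Γ₂ η) {x | D₁.f x < 2 * η} := by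
  have h2 : ContMDiffOn (𝓡∂ (k + 1)) (𝓡∂ (k + 1)) ∞ (fun x => Γ₁.Fl x (2 * η))
      {x | D₁.f x < 2 * η} :=
    Γ₁.contMDiffOn_Fl_comp contMDiffOn_id contMDiffOn_const
      (fun x hx => by show D₁.f x < Γ₁.a; have : D₁.f x < 2 * η := hx; linarith)
      (fun x _ => by linarith) (fun x _ => by linarith)
  refine Γ₂.contMDiffOn_ret_comp h2 fun x hx => ?_
  have hx' : D₁.f x < 2 * η := hx
  rw [hf, Γ₁.f_Fl (by linarith) ⟨by linarith [D₁.f_nonneg x], by linarith⟩]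
  linarith

end Cover

end Diffeo

end FlowoutInput

end Literature.Topology.FourManifolds
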